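import Summits.AtomisticToContinuum.BoseEinsteinCondensation.Theorems.BECPhaseQuadratureSumRuleSumRuleChainGluePerMode
import HarnessLib

/-!
# Route `BECPhaseQuadratureSumRule`, glue `SumRuleChainGlue` (stmt-AtomisticToContinuum-12627) —
# helper: the dichotomy `x(1 - x) ≤ ζ + E < 3/16 ⇒ x ∉ (¼, ¾)` for the condensate fraction `x = n₀/N`

For a periodic trial state `Ψ` of `N = n + 2` bosons: the instance at `Ψ` of `CondensateNumberConcentration`
(`N(N-1)L⁻⁶∫|∫∫Ψ|² + n₀ ≤ n₀² + ζN²`) and a bound `Σ_{p≠0} ‖a_p a_0Ψ‖² ≤ E N²` on the mode sum give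
`N n₀ ≤ n₀² + (ζ + E)N²` (`(N-1) n₀ = Σ_p ‖a_p a_0Ψ‖²` and its `p = 0` term is the pair term, file `…PerMode`),
whence, if `ζ + E < 3/16`, `n₀ ≤ N/4` or `n₀ ≥ 3N/4` (`condensateOccupation_dichotomy`).
-/

noncomputable section

open MeasureTheory Filter Set
open scoped ENNReal NNReal Topology BigOperators

namespace Summit.AtomisticToContinuum.BoseEinsteinCondensation.Theorems.SumRuleChainGlue

open Literature.MathematicalPhysics.QuantumManyBody.BoseGas

variable {n : ℕ} {L : ℝ}

/-- The condensate occupation of a periodic trial state is at most `N`. -/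
theorem condensateOccupation_le_card (hL : 0 < L) (Ψ : PeriodicTrialState (n + 2) L) :
    condensateOccupation (n + 2) L Ψ.ψ ≤ ((n + 2 : ℕ) : ℝ≥0∞) := by
  have h := tsum_momentumOccupation_trialState hL Ψ
  rw [← h, ← momentumOccupation_zero]
  exact ENNReal.le_tsum 0

/-- **`N n₀ ≤ n₀² + (ζ + E) N²`** from the instance of `CondensateNumberConcentration` and the mode-sum bound. -/
theorem card_mul_condensateOccupation_le (hL : 0 < L) (Ψ : PeriodicTrialState (n + 2) L) {ζ E : ℝ} (hζ : 0 ≤ ζ)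
    (hE : 0 ≤ E)
    (hV : ((n + 2 : ℕ) : ℝ≥0∞) * ((n + 1 : ℕ) : ℝ≥0∞) * (∫⁻ Y in cellN n L, (‖∫ x in cell L, ∫ y in cell L,
        Ψ.ψ (Matrix.vecCons x (Matrix.vecCons y Y))‖₊ : ℝ≥0∞) ^ 2) / ENNReal.ofReal (L ^ 6) +
        condensateOccupation (n + 2) L Ψ.ψ ≤
      condensateOccupation (n + 2) L Ψ.ψ ^ 2 + ENNReal.ofReal (ζ * ((n : ℝ) + 2) ^ 2))
    (hT : ∑' p : Fin 3 → ℤ, (if p = 0 then 0 else pairOcc L p Ψ.ψ) ≤ ENNReal.ofReal (E * ((n + 2 : ℕ) : ℝ) ^ 2)) :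
    ((n + 2 : ℕ) : ℝ≥0∞) * condensateOccupation (n + 2) L Ψ.ψ ≤
      condensateOccupation (n + 2) L Ψ.ψ ^ 2 + ENNReal.ofReal ((ζ + E) * ((n + 2 : ℕ) : ℝ) ^ 2) := by
  have hsum := tsum_pairOcc hL Ψ
  rw [ENNReal.tsum_eq_add_tsum_ite (0 : Fin 3 → ℤ), pairOcc_zero hL Ψ] at hsum
  have hcast : ((n + 2 : ℕ) : ℝ≥0∞) = ((n + 1 : ℕ) : ℝ≥0∞) + 1 := by push_cast; ring
  calc ((n + 2 : ℕ) : ℝ≥0∞) * condensateOccupation (n + 2) L Ψ.ψ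
      = ((n + 1 : ℕ) : ℝ≥0∞) * condensateOccupation (n + 2) L Ψ.ψ + condensateOccupation (n + 2) L Ψ.ψ := by
        rw [hcast, add_mul, one_mul]
    _ = ((n + 2 : ℕ) : ℝ≥0∞) * ((n + 1 : ℕ) : ℝ≥0∞) * (∫⁻ Y in cellN n L, (‖∫ x in cell L, ∫ y in cell L,
          Ψ.ψ (Matrix.vecCons x (Matrix.vecCons y Y))‖₊ : ℝ≥0∞) ^ 2) / ENNReal.ofReal (L ^ 6) +
          condensateOccupation (n + 2) L Ψ.ψ + ∑' p : Fin 3 → ℤ, (if p = 0 then 0 else pairOcc L p Ψ.ψ) := by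
        rw [← hsum]; ring
    _ ≤ condensateOccupation (n + 2) L Ψ.ψ ^ 2 + ENNReal.ofReal (ζ * ((n : ℝ) + 2) ^ 2) +
          ENNReal.ofReal (E * ((n + 2 : ℕ) : ℝ) ^ 2) := add_le_add hV hT
    _ = condensateOccupation (n + 2) L Ψ.ψ ^ 2 + ENNReal.ofReal ((ζ + E) * ((n + 2 : ℕ) : ℝ) ^ 2) := by
        rw [add_assoc, ← ENNReal.ofReal_add (by positivity) (by positivity)]
        congr 2
        push_cast
        ring

/-- **The dichotomy.** If `N n₀ ≤ n₀² + θ N²` with `θ < 3/16`, then `n₀ ≤ N/4` or `3N/4 ≤ n₀` (the parabola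
`x(1-x)` exceeds `3/16` on `(¼, ¾)`). -/
theorem condensateOccupation_dichotomy (hL : 0 < L) (Ψ : PeriodicTrialState (n + 2) L) {θ : ℝ} (hθ : 0 ≤ θ)
    (hθ3 : θ < 3 / 16)
    (h : ((n + 2 : ℕ) : ℝ≥0∞) * condensateOccupation (n + 2) L Ψ.ψ ≤
      condensateOccupation (n + 2) L Ψ.ψ ^ 2 + ENNReal.ofReal (θ * ((n + 2 : ℕ) : ℝ) ^ 2)) :
    condensateOccupation (n + 2) L Ψ.ψ ≤ ENNReal.ofReal (((n + 2 : ℕ) : ℝ) / 4) ∨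
      ENNReal.ofReal (3 * ((n + 2 : ℕ) : ℝ) / 4) ≤ condensateOccupation (n + 2) L Ψ.ψ := by
  set N : ℝ := ((n + 2 : ℕ) : ℝ) with hN
  have hNpos : 0 < N := by rw [hN]; positivity
  have hle : condensateOccupation (n + 2) L Ψ.ψ ≤ ((n + 2 : ℕ) : ℝ≥0∞) := condensateOccupation_le_card hL Ψ
  have htop : condensateOccupation (n + 2) L Ψ.ψ ≠ ⊤ := ne_top_of_le_ne_top (ENNReal.natCast_ne_top _) hle
  set y : ℝ := (condensateOccupation (n + 2) L Ψ.ψ).toReal with hy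
  have hy0 : 0 ≤ y := ENNReal.toReal_nonneg
  have hyN : y ≤ N := by
    rw [hy, hN, ← ENNReal.toReal_natCast]
    exact ENNReal.toReal_mono (ENNReal.natCast_ne_top _) hle
  have hn0 : condensateOccupation (n + 2) L Ψ.ψ = ENNReal.ofReal y := by rw [hy, ENNReal.ofReal_toReal htop]
  -- the real inequality `N y ≤ y² + θ N²`
  have hreal : N * y ≤ y ^ 2 + θ * N ^ 2 := by
    have h' := h
    rw [hn0, show ((n + 2 : ℕ) : ℝ≥0∞) = ENNReal.ofReal N by rw [hN, ENNReal.ofReal_natCast],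
      ← ENNReal.ofReal_mul hNpos.le, ← ENNReal.ofReal_pow hy0, ← ENNReal.ofReal_add (by positivity) (by positivity)] at h'
    exact (ENNReal.ofReal_le_ofReal_iff (by positivity)).1 h'
  rw [hn0]
  by_contra hcon
  rw [not_or] at hcon
  obtain ⟨h1, h2⟩ := hcon
  have h1' : N / 4 < y := by
    by_contra h1'
    exact h1 (ENNReal.ofReal_le_ofReal (not_lt.1 h1'))
  have h2' : y < 3 * N / 4 := by
    by_contra h2'
    exact h2 (ENNReal.ofReal_le_ofReal (not_lt.1 h2'))
  have hprod : 0 < (y - N / 4) * (3 * N / 4 - y) := mul_pos (by linarith) (by linarith)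
  nlinarith [hprod, hreal, hθ3, sq_nonneg N, mul_pos hNpos hNpos]

end Summit.AtomisticToContinuum.BoseEinsteinCondensation.Theorems.SumRuleChainGlue

end
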